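import Summits.Ventures.QEC.Census.CertChunks
import Summits.Ventures.QEC.Census.BB.BB72.Cert
import HarnessLib

/-!
# `BB72` — KERNEL-tier lower-bound replay, side Z, leaf file 10/10 (emitted by qec-search-7)

Bruteforce replay (CERT-FORMAT v1 §5.1, lemma L3) of the certificate `7e943c5a566adc43`: every Z-type operator of weight
`1 … 5` has nonzero syndrome (rows `cert.HX`) or is allow-listed (allow-list []). This file holds
9 packed chunk evaluations (`chunk1R`/`chunk2R` of `Census/CertChunks.lean` over `posList 72 cert.HX`), total
1385979 scan end points, each closed by `decide +kernel` — tier KERNEL (CERTIFIED): axioms ⊆ {propext, Classical.choice,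
Quot.sound}. Assembled in `BB/BB72/KernelZ.lean`. Do not edit; re-emit (HOME/census/search-7/emit_kernel.py).
-/

namespace Summit.Ventures.QEC.Census.BB72

/-- Level-1 chunks `i`, `27 ≤ i < 28`, side Z of `BB72` (149986 end points): pass. -/
theorem kZ1_27 : chunk1R (leafTest []) (posList 72 cert.HX) 4 27 1 = true := by decide +kernel

/-- Level-1 chunks `i`, `28 ≤ i < 29`, side Z of `BB72` (136698 end points): pass. -/
theorem kZ1_28 : chunk1R (leafTest []) (posList 72 cert.HX) 4 28 1 = true := by decide +kernel

/-- Level-1 chunks `i`, `29 ≤ i < 30`, side Z of `BB72` (124314 end points): pass. -/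
theorem kZ1_29 : chunk1R (leafTest []) (posList 72 cert.HX) 4 29 1 = true := by decide +kernel

/-- Level-1 chunks `i`, `30 ≤ i < 31`, side Z of `BB72` (112792 end points): pass. -/
theorem kZ1_30 : chunk1R (leafTest []) (posList 72 cert.HX) 4 30 1 = true := by decide +kernel

/-- Level-1 chunks `i`, `31 ≤ i < 33`, side Z of `BB72` (194262 end points): pass. -/
theorem kZ1_31 : chunk1R (leafTest []) (posList 72 cert.HX) 4 31 2 = true := by decide +kernel

/-- Level-1 chunks `i`, `33 ≤ i < 35`, side Z of `BB72` (157512 end points): pass. -/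
theorem kZ1_33 : chunk1R (leafTest []) (posList 72 cert.HX) 4 33 2 = true := by decide +kernel

/-- Level-1 chunks `i`, `35 ≤ i < 38`, side Z of `BB72` (179204 end points): pass. -/
theorem kZ1_35 : chunk1R (leafTest []) (posList 72 cert.HX) 4 35 3 = true := by decide +kernel

/-- Level-1 chunks `i`, `38 ≤ i < 43`, side Z of `BB72` (184616 end points): pass. -/
theorem kZ1_38 : chunk1R (leafTest []) (posList 72 cert.HX) 4 38 5 = true := by decide +kernel

/-- Level-1 chunks `i`, `43 ≤ i < 72`, side Z of `BB72` (146595 end points): pass. -/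
theorem kZ1_43 : chunk1R (leafTest []) (posList 72 cert.HX) 4 43 29 = true := by decide +kernel

end Summit.Ventures.QEC.Census.BB72
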